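import Literature.ModelTheory.ExponentialFields.ExpTermReduction
import Literature.ModelTheory.ExponentialFields.RealExpFieldOMinimal
import Literature.ModelTheory.ExponentialFields.Wilkie1989KhovanskiiProofs
import HarnessLib

/-!
# Model completeness + Khovanskii ⇒ o-minimality, for exp-term definable expansions of the models of `T_exp`

Topic `Literature/ModelTheory/ExponentialFields`.  Wilkie 1996, §1 and Theorem 11.1: the model
completeness of an expansion of `ℝ̄` by (restricted Pfaffian / exponential) functions, together
with Khovanskii's finiteness theorem, yields its o-minimality.  This file proves the general
engine behind that remark, for expansions of the models of `T_exp`: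

Let `L'` be an ordered language interpreted on every model `K` of `T_exp` (instances
`[∀ K, L'.Structure K] [∀ K, L'.OrderedStructure K]`), `T'` an `L'`-theory true in all these
structures, and assume
* (`hnf`) uniformly in `K`, every existential `L'`-formula is the projection of ONE exponential
  term equation (`RealExpModel.IsExpTermDefinable`; for `L_e` this is `ETermReduction.lean`, in
  general `ExpTermReduction.lean`);
* (`htr`) `L'`-sentences transfer between any `K` and `ℝ` (`realModel`);
* (`hMC`) `T'` is model complete.
Then **every `K | L'` is o-minimal** (`isOMinimal_of_isModelComplete`): every subset of `K`
definable with parameters in `K | L'` is a finite union of points and open intervals with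
endpoints in `K`.  Khovanskii's theorem enters through the proved
`Wilkie1989_khovanskiiProposition_holds`.  The instances `L' = L_e` (`EOMinimal.lean`) and
`L' = L_{exp↾}` give the o-minimality halves of Wilkie's Theorem 11.1 / den Besten's
Corollary 4.1.7 from the First Main Theorem.

## The proof

Let `φ(c̄, x)` be an `L'`-formula (`c̄` parameters, `x` the line variable).
1. (`ℝ`, uniformly in `c̄`.)  By model completeness `φ` is `T'`-equivalent to an existential
   formula, which is a projection of one exponential term equation (`hnf`); by penalisation,
   Sard and Khovanskii (`RealExpFieldOMinimal.lean`, here in the parameter-uniform form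
   `exists_noChain_proj_zeroSet_uniform`) the real sections `S_c̄ = {x ∈ ℝ | φ(c̄, x)}` admit no
   alternating chain of length `K + 1`, `K` independent of `c̄`; hence
   (`finite_frontier_and_ncard_le`) the frontier of `S_c̄` has at most `2K` points, and `S_c̄` is
   constant on each cell of any tuple `b̄ ⊇ frontier S_c̄` (`mem_iff_of_sameCell`).
2. (Transfer.)  "For all `c̄` there are `b₁, …, b_N` such that membership in `S_c̄` only depends on
   the position relative to the `bᵢ`" is ONE `L'`-sentence (`cellSentence`), true in `ℝ`, hence
   in every `K` (`htr`).
3. (`K`.)  A subset of `K` with that property is a finite union of cells, i.e. of points and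
   intervals with endpoints among the `bᵢ` (`isFiniteUnionOfIntervals_of_cells`).

## References

* A. J. Wilkie, J. Amer. Math. Soc. 9 (1996), §1 and Theorem 11.1 (p. 1091). [WilkieJAMS1996]
* M. den Besten, MSc thesis, Utrecht 2016, Corollary 4.1.7, Theorem 7.2.1, Proposition A.2.5.
  [DenBesten2016]
* A. Pillay, C. Steinhorn, *Definable sets in ordered structures I*, Trans. AMS 295 (1986)
  (o-minimal structures; with J. Knight, part II: uniform finiteness and o-minimality of all
  models of the theory). [PillaySteinhorn1986]
-/

noncomputable section

open FirstOrder FirstOrder.Language FirstOrder.Language.Structure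
open scoped FirstOrder
open Set

namespace Literature.ModelTheory.ExponentialFields

namespace OMinimalOfModelComplete

open RealExpModel WilkieOMinimal

/-! ### Step 1a: Khovanskii's bound forbids long alternating chains, uniformly in the parameters -/

/-- The property "no strictly increasing `(K+1)`-chain outside `S` has a point of `S` in each of
its `K` gaps" (at most `K` alternations). [folklore] -/
def NoChain (K : ℕ) (S : Set ℝ) : Prop :=
  ∀ g : Fin (K + 1) → ℝ, StrictMono g → (∀ i, g i ∉ S) →
    ∃ i : Fin K, ∀ x ∈ S, ¬ (g (Fin.castSucc i) < x ∧ x < g (Fin.succ i))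

/-- **No long alternating chains in projections of exponential zero sets, uniformly in the
parameters** (the bound of `WilkieOMinimal.exists_noChain_proj_zeroSet`, which depends only on
the term: Khovanskii's bound for the penalised system is uniform in all its parameters
`(c̄, ε, ā)`). [folklore] -/
theorem exists_noChain_proj_zeroSet_uniform {m n : ℕ}
    (t : Language.orderedExpRing.Term (Fin m ⊕ Fin (n + 2))) :
    ∃ K : ℕ, ∀ c : Fin m → ℝ,
      NoChain K {x : ℝ | ∃ y : Fin (n + 2) → ℝ, y 0 = x ∧ t.realize (Sum.elim c y) = 0} := by
  obtain ⟨N₀, hN₀⟩ := Wilkie1989_khovanskiiProposition_holds.exists_encard_le (m + (n + 3)) (n + 2)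
    (by omega) (penSys t)
  refine ⟨N₀ + 1, fun c g hg hgP => ?_⟩
  by_contra hall
  push Not at hall
  set G : (Fin (n + 2) → ℝ) → ℝ := fun y => (t.realize (Sum.elim c y)) ^ 2 with hGdef
  have hGc : Continuous G := (continuous_realize t c).pow 2
  have hG0 : ∀ y, 0 ≤ G y := fun y => sq_nonneg _
  have hwall : ∀ i y, y 0 = g i → G y ≠ 0 := by
    intro i y hy hGy
    have hty : t.realize (Sum.elim c y) = 0 := by
      have : (t.realize (Sum.elim c y)) ^ 2 = 0 := hGy
      exact pow_eq_zero_iff (n := 2) (by norm_num) |>.1 this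
    exact hgP i ⟨y, hy, hty⟩
  have hin : ∀ i : Fin (N₀ + 1), ∃ z, G z = 0 ∧ g (Fin.castSucc i) < z 0 ∧ z 0 < g (Fin.succ i) := by
    intro i
    obtain ⟨x, ⟨y, hy0, hty⟩, hx1, hx2⟩ := hall i
    refine ⟨y, ?_, hy0 ▸ hx1, hy0 ▸ hx2⟩
    show (t.realize (Sum.elim c y)) ^ 2 = 0
    rw [hty, sq, mul_zero]
  have hpen : ∀ i : Fin (N₀ + 1), ∃ ε₀ : ℝ, 0 < ε₀ ∧ ∀ ε : ℝ, 0 < ε → ε < ε₀ →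
      ∀ a : Fin (n + 2) → ℝ, (∀ j, |a j| ≤ 1) →
        ∃ y, g (Fin.castSucc i) < y 0 ∧ y 0 < g (Fin.succ i) ∧
          IsLocalMin (fun y => G y + ε * ∑ j, (y j - a j) ^ 2) y := fun i =>
    exists_isLocalMin_penalised G hGc hG0 (hwall _) (hwall _) (hin i)
  choose ε₀ hε₀ hε₀spec using hpen
  set εm : ℝ := Finset.univ.inf' Finset.univ_nonempty ε₀ with hεm
  have hεmpos : 0 < εm := by
    rw [hεm, Finset.lt_inf'_iff]
    exact fun i _ => hε₀ i
  set ε : ℝ := εm / 2 with hεdef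
  have hεpos : 0 < ε := by positivity
  have hεlt : ∀ i, ε < ε₀ i := fun i =>
    lt_of_lt_of_le (by rw [hεdef]; linarith) (Finset.inf'_le ε₀ (Finset.mem_univ i))
  obtain ⟨a, ha1, hns⟩ := exists_centre_nonsingular t c hεpos
  have hpts : ∀ i : Fin (N₀ + 1), ∃ y, g (Fin.castSucc i) < y 0 ∧ y 0 < g (Fin.succ i) ∧
      y ∈ realNonsingularZeroSet (penSys t) (params c ε a) := by
    intro i
    obtain ⟨y, hy1, hy2, hmin⟩ := hε₀spec i ε hεpos (hεlt i) a ha1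
    exact ⟨y, hy1, hy2, hns y fun r => realize_penSys_eq_zero_of_isLocalMin t c ε a hmin r⟩
  choose y hy1 hy2 hyV using hpts
  have hsep : ∀ i j : Fin (N₀ + 1), i < j → y i 0 < y j 0 := by
    intro i j hij
    calc y i 0 < g (Fin.succ i) := hy2 i
      _ ≤ g (Fin.castSucc j) := hg.monotone (by
          rw [Fin.le_iff_val_le_val, Fin.val_succ, Fin.val_castSucc]
          exact Nat.succ_le_of_lt hij)
      _ < y j 0 := hy1 j
  have hinj : Function.Injective y := by
    intro i j hij
    by_contra hne
    rcases lt_or_gt_of_ne hne with h | h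
    · have := hsep i j h
      rw [hij] at this
      exact lt_irrefl _ this
    · have := hsep j i h
      rw [hij] at this
      exact lt_irrefl _ this
  exact (encard_le_coe_iff_forall_not_injective.1 (hN₀ (params c ε a)) y hyV) hinj

/-! ### Step 1b: boundedly many alternations ⇒ boundedly many frontier points -/

/-- A preconnected subset of `ℝ` missing the frontier of `S` lies inside `S` or outside `S`.
[folklore] -/
theorem subset_or_disjoint_of_inter_frontier_eq_empty {I S : Set ℝ} (hI : IsPreconnected I)
    (h : I ∩ frontier S = ∅) : I ⊆ S ∨ Disjoint I S := by
  by_contra hcon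
  push Not at hcon
  obtain ⟨h₁, h₂⟩ := hcon
  obtain ⟨y, hyI, hyS⟩ := not_subset.1 h₁
  obtain ⟨x, hxI, hxS⟩ := not_disjoint_iff.1 h₂
  -- cover `I` by the two disjoint open sets `interior S` and `(closure S)ᶜ`
  have hcov : I ⊆ interior S ∪ (closure S)ᶜ := by
    intro z hz
    by_contra hz'
    simp only [mem_union, mem_compl_iff, not_or, not_not] at hz'
    have : z ∈ I ∩ frontier S := ⟨hz, hz'.2, hz'.1⟩
    rw [h] at this
    exact this
  have hx' : x ∈ interior S := by
    rcases hcov hxI with h' | h'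
    · exact h'
    · exact absurd (subset_closure hxS) h'
  have hy' : y ∈ (closure S)ᶜ := by
    rcases hcov hyI with h' | h'
    · exact absurd (interior_subset h') hyS
    · exact h'
  have hdisj : Disjoint (interior S) (closure S)ᶜ :=
    disjoint_compl_right.mono_left interior_subset_closure
  have key := hI.subset_left_of_subset_union isOpen_interior isClosed_closure.isOpen_compl
    hdisj hcov ⟨x, hxI, hx'⟩
  exact (key hyI) |> fun hyint => hy' (subset_closure (interior_subset hyint))

/-- **At most `2K` frontier points.** If `S ⊆ ℝ` has at most `K` alternations (`NoChain K S`),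
then no `2K + 1` points lie on the frontier of `S`: around frontier points one picks,
alternately, points outside and inside `S`, producing a forbidden chain. [folklore] -/
theorem not_subset_frontier_of_card {K : ℕ} {S : Set ℝ} (hS : NoChain K S) (F : Finset ℝ)
    (hcard : F.card = 2 * K + 1) : ¬ (↑F : Set ℝ) ⊆ frontier S := by
  intro hF
  set f := F.orderEmbOfFin hcard with hf
  have hfF : ∀ j, f j ∈ frontier S := fun j => hF (F.orderEmbOfFin_mem hcard j)
  -- separating neighbourhoods `(lower j, upper j)` of the points `f j`
  let mid : Fin (2 * K) → ℝ := fun i => (f (Fin.castSucc i) + f (Fin.succ i)) / 2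
  let lower : Fin (2 * K + 1) → ℝ := fun j =>
    if h : (j : ℕ) = 0 then f j - 1 else mid ⟨(j : ℕ) - 1, by have := j.2; omega⟩
  let upper : Fin (2 * K + 1) → ℝ := fun j =>
    if h : (j : ℕ) = 2 * K then f j + 1 else mid ⟨j, by have := j.2; omega⟩
  have hmid1 : ∀ i, f (Fin.castSucc i) < mid i := fun i => by
    have := f.strictMono (Fin.castSucc_lt_succ (i := i))
    show f (Fin.castSucc i) < (f (Fin.castSucc i) + f (Fin.succ i)) / 2
    linarith
  have hmid2 : ∀ i, mid i < f (Fin.succ i) := fun i => by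
    have := f.strictMono (Fin.castSucc_lt_succ (i := i))
    show (f (Fin.castSucc i) + f (Fin.succ i)) / 2 < f (Fin.succ i)
    linarith
  have hmidmono : Monotone mid := by
    intro i i' hii'
    rcases hii'.lt_or_eq with hlt | rfl
    · have h1 : Fin.succ i ≤ Fin.castSucc i' := by
        rw [Fin.le_iff_val_le_val, Fin.val_succ, Fin.val_castSucc]; exact hlt
      exact ((hmid2 i).trans_le ((f.monotone h1).trans (hmid1 i').le)).le
    · exact le_rfl
  have hlower : ∀ j, lower j < f j := fun j => by
    by_cases h : (j : ℕ) = 0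
    · simp only [lower, h, ↓reduceDIte]; linarith
    · simp only [lower, h, ↓reduceDIte]
      have e : Fin.succ (⟨(j : ℕ) - 1, by have := j.2; omega⟩ : Fin (2 * K)) = j :=
        Fin.ext (by simp only [Fin.val_succ]; omega)
      have := hmid2 ⟨(j : ℕ) - 1, by have := j.2; omega⟩
      rwa [e] at this
  have hupper : ∀ j, f j < upper j := fun j => by
    by_cases h : (j : ℕ) = 2 * K
    · simp only [upper, h, ↓reduceDIte]; linarith
    · simp only [upper, h, ↓reduceDIte]
      have e : Fin.castSucc (⟨j, by have := j.2; omega⟩ : Fin (2 * K)) = j := Fin.ext rfl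
      have := hmid1 ⟨j, by have := j.2; omega⟩
      rwa [e] at this
  have hsep : ∀ j j' : Fin (2 * K + 1), j < j' → upper j ≤ lower j' := by
    intro j j' hjj'
    rw [Fin.lt_def] at hjj'
    have h1 : (j : ℕ) ≠ 2 * K := by have := j'.2; omega
    have h2 : (j' : ℕ) ≠ 0 := by omega
    simp only [upper, lower, h1, h2, ↓reduceDIte]
    exact hmidmono (by rw [Fin.le_iff_val_le_val]; dsimp only; omega)
  -- near each frontier point, a point outside `S` and a point inside `S`
  have hnhds : ∀ j, Ioo (lower j) (upper j) ∈ nhds (f j) := fun j =>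
    Ioo_mem_nhds (hlower j) (hupper j)
  have hout : ∀ j, ∃ o, o ∈ Ioo (lower j) (upper j) ∧ o ∉ S := fun j => by
    have h := hfF j
    rw [frontier_eq_closure_inter_closure] at h
    obtain ⟨o, ho, hoS⟩ := mem_closure_iff_nhds.1 h.2 _ (hnhds j)
    exact ⟨o, ho, hoS⟩
  have hinn : ∀ j, ∃ s, s ∈ Ioo (lower j) (upper j) ∧ s ∈ S := fun j => by
    have h := hfF j
    rw [frontier_eq_closure_inter_closure] at h
    obtain ⟨s, hs, hsS⟩ := mem_closure_iff_nhds.1 h.1 _ (hnhds j)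
    exact ⟨s, hs, hsS⟩
  choose o ho hoS using hout
  choose s hs hsS using hinn
  -- even indices `2i` (`i ≤ K`) and odd indices `2i + 1` (`i < K`)
  let ev : Fin (K + 1) → Fin (2 * K + 1) := fun i => ⟨2 * i, by have := i.2; omega⟩
  let od : Fin K → Fin (2 * K + 1) := fun i => ⟨2 * i + 1, by have := i.2; omega⟩
  let g : Fin (K + 1) → ℝ := fun i => o (ev i)
  have hg : StrictMono g := by
    intro i i' hii'
    have hlt : ev i < ev i' := by
      rw [Fin.lt_def] at hii' ⊢; dsimp only [ev]; omega
    exact (ho (ev i)).2.trans_le ((hsep _ _ hlt).trans (ho (ev i')).1.le)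
  obtain ⟨i, hi⟩ := hS g hg fun i => hoS (ev i)
  refine hi (s (od i)) (hsS (od i)) ⟨?_, ?_⟩
  · have hlt : ev (Fin.castSucc i) < od i := by
      rw [Fin.lt_def]; dsimp only [ev, od]; rw [Fin.val_castSucc]; omega
    exact (ho _).2.trans_le ((hsep _ _ hlt).trans (hs (od i)).1.le)
  · have hlt : od i < ev (Fin.succ i) := by
      rw [Fin.lt_def]; dsimp only [ev, od]; rw [Fin.val_succ]; omega
    exact (hs _).2.trans_le ((hsep _ _ hlt).trans (ho _).1.le)

/-- **The frontier of a set with at most `K` alternations is finite with at most `2K` points.**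
[folklore] -/
theorem finite_frontier_and_ncard_le {K : ℕ} {S : Set ℝ} (hS : NoChain K S) :
    (frontier S).Finite ∧ (frontier S).ncard ≤ 2 * K := by
  have hfin : (frontier S).Finite := by
    by_contra hinf
    obtain ⟨F, hF, hcard⟩ := Set.Infinite.exists_subset_card_eq hinf (2 * K + 1)
    exact not_subset_frontier_of_card hS F hcard hF
  refine ⟨hfin, ?_⟩
  by_contra hlt
  push Not at hlt
  have hle : 2 * K + 1 ≤ hfin.toFinset.card := by
    rwa [← Set.ncard_eq_toFinset_card _ hfin]
  obtain ⟨F, hF, hcard⟩ := Finset.exists_subset_card_eq hle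
  refine not_subset_frontier_of_card hS F hcard fun z hz => ?_
  exact hfin.mem_toFinset.1 (hF hz)

/-! ### Step 1c: cells of a tuple of cut points -/

/-- `x` and `x'` lie in the same cell of the cut points `b̄`: the same position (`≤`, `≥`)
relative to every `bᵢ`. [folklore] -/
def SameCell {M : Type*} [LE M] {N : ℕ} (b : Fin N → M) (x x' : M) : Prop :=
  ∀ i, (x ≤ b i ↔ x' ≤ b i) ∧ (b i ≤ x ↔ b i ≤ x')

/-- If the frontier of `S ⊆ ℝ` is among the cut points, then membership in `S` is constant on
cells. [folklore] -/
theorem mem_iff_of_sameCell {N : ℕ} {S : Set ℝ} (b : Fin N → ℝ)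
    (hb : frontier S ⊆ Set.range b) {x x' : ℝ} (h : SameCell b x x') : x ∈ S ↔ x' ∈ S := by
  by_cases hxx' : x = x'
  · rw [hxx']
  have hI : uIcc x x' ∩ frontier S = ∅ := by
    apply Set.eq_empty_of_forall_notMem
    rintro z ⟨hz, hzf⟩
    obtain ⟨i, rfl⟩ := hb hzf
    obtain ⟨h1, h2⟩ := h i
    rcases le_total x x' with hle | hle
    · rw [uIcc_of_le hle] at hz
      have hx'le : x' ≤ b i := h1.1 hz.1
      have heq : x' = b i := le_antisymm hx'le hz.2
      have hxge : b i ≤ x := h2.2 (heq ▸ le_rfl)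
      exact hxx' (le_antisymm hle (heq ▸ hxge))
    · rw [uIcc_of_ge hle] at hz
      have hxle : x ≤ b i := h1.2 hz.1
      have heq : x = b i := le_antisymm hxle hz.2
      have hx'ge : b i ≤ x' := h2.1 (heq ▸ le_rfl)
      exact hxx' (le_antisymm (heq ▸ hx'ge) hle |>.symm ▸ rfl) |>.elim
  rcases subset_or_disjoint_of_inter_frontier_eq_empty isPreconnected_uIcc hI with hsub | hdis
  · exact ⟨fun _ => hsub right_mem_uIcc, fun _ => hsub left_mem_uIcc⟩
  · exact ⟨fun hx => absurd hx (disjoint_left.1 hdis left_mem_uIcc),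
      fun hx' => absurd hx' (disjoint_left.1 hdis right_mem_uIcc)⟩

/-- A finite set of reals with at most `N` elements is contained in the range of an `N`-tuple
(for `N = 0` the set is empty). [folklore] -/
theorem exists_range_superset_of_ncard_le {F : Set ℝ} (hF : F.Finite) {N : ℕ}
    (hN : F.ncard ≤ N) : ∃ b : Fin N → ℝ, F ⊆ Set.range b := by
  classical
  obtain ⟨e⟩ : Nonempty (Fin hF.toFinset.card ≃ ↥hF.toFinset) :=
    ⟨(hF.toFinset.equivFin).symm⟩
  have hle : hF.toFinset.card ≤ N := by rwa [← Set.ncard_eq_toFinset_card F hF]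
  by_cases hempty : F = ∅
  · exact ⟨fun _ => 0, by simp [hempty]⟩
  obtain ⟨d, hd⟩ := Set.nonempty_iff_ne_empty.2 hempty
  refine ⟨fun i => if h : (i : ℕ) < hF.toFinset.card then (e ⟨i, h⟩ : ℝ) else d, fun z hz => ?_⟩
  have hz' : z ∈ hF.toFinset := hF.mem_toFinset.2 hz
  obtain ⟨k, hk⟩ : ∃ k : Fin hF.toFinset.card, (e k : ℝ) = z :=
    ⟨e.symm ⟨z, hz'⟩, by simp⟩
  refine ⟨⟨k, lt_of_lt_of_le k.2 hle⟩, ?_⟩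
  simp only [Fin.is_lt, ↓reduceDIte, Fin.eta]
  convert hk


/-! ### Step 2: the cell sentence and its transfer -/

section Sentence

universe u' v'

variable {L' : FirstOrder.Language.{u', v'}} [L'.IsOrdered] {p : ℕ}

/-- The `L'`-formula `SameCell(b̄; x, x') → (φ(c̄, x) ↔ φ(c̄, x'))` in the variables
`((c̄, b̄), (x, x'))` (`L'` an ordered language). [folklore] -/
def cellBody (φ : L'.Formula (Fin p ⊕ Fin 1)) (N : ℕ) : L'.Formula ((Fin p ⊕ Fin N) ⊕ Fin 2) :=
  let x : L'.Term (((Fin p ⊕ Fin N) ⊕ Fin 2) ⊕ Fin 0) := var (Sum.inl (Sum.inr 0))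
  let x' : L'.Term (((Fin p ⊕ Fin N) ⊕ Fin 2) ⊕ Fin 0) := var (Sum.inl (Sum.inr 1))
  let b : Fin N → L'.Term (((Fin p ⊕ Fin N) ⊕ Fin 2) ⊕ Fin 0) := fun i =>
    var (Sum.inl (Sum.inl (Sum.inr i)))
  (Formula.iInf fun i => ((x.le (b i)).iff (x'.le (b i))) ⊓ (((b i).le x).iff ((b i).le x'))) ⟹
    ((φ.relabel (Sum.map Sum.inl fun _ => (0 : Fin 2))).iff
      (φ.relabel (Sum.map Sum.inl fun _ => (1 : Fin 2))))

/-- **The cell sentence** `∀ c̄ ∃ b₁ … b_N ∀ x x' (SameCell(b̄; x, x') → (φ(c̄, x) ↔ φ(c̄, x')))`: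
"every section of `φ` is a union of cells of some `N` cut points" (uniform finiteness for the
family `φ(c̄, ·)` in the sense of Pillay–Steinhorn). [folklore] -/
def cellSentence (φ : L'.Formula (Fin p ⊕ Fin 1)) (N : ℕ) : L'.Sentence :=
  Formula.iAlls (Fin p)
    ((Formula.iExs (Fin N) (Formula.iAlls (Fin 2) (cellBody φ N))).relabel Sum.inr)

/-- Semantics of the cell sentence in an ordered `L'`-structure. [folklore] -/
theorem realize_cellSentence (M : Type*) [L'.Structure M] [LE M] [L'.OrderedStructure M]
    [Nonempty M] (φ : L'.Formula (Fin p ⊕ Fin 1)) (N : ℕ) :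
    M ⊨ cellSentence φ N ↔
      ∀ c : Fin p → M, ∃ b : Fin N → M, ∀ x x' : M, SameCell b x x' →
        (φ.Realize (Sum.elim c fun _ => x) ↔ φ.Realize (Sum.elim c fun _ => x')) := by
  have hbody : ∀ (c : Fin p → M) (b : Fin N → M) (xx : Fin 2 → M),
      (cellBody φ N).Realize (Sum.elim (Sum.elim c b) xx) ↔
        (SameCell b (xx 0) (xx 1) →
          (φ.Realize (Sum.elim c fun _ => xx 0) ↔ φ.Realize (Sum.elim c fun _ => xx 1))) := by
    intro c b xx
    have e0 : (Sum.elim (Sum.elim c b) xx) ∘ Sum.map Sum.inl (fun _ : Fin 1 => (0 : Fin 2)) =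
        Sum.elim c fun _ => xx 0 := by
      funext z; rcases z with z | z <;> rfl
    have e1 : (Sum.elim (Sum.elim c b) xx) ∘ Sum.map Sum.inl (fun _ : Fin 1 => (1 : Fin 2)) =
        Sum.elim c fun _ => xx 1 := by
      funext z; rcases z with z | z <;> rfl
    simp only [cellBody, Formula.realize_imp, Formula.realize_iInf, Formula.realize_inf,
      Formula.realize_iff, Formula.realize_relabel, e0, e1, SameCell]
    simp only [Formula.Realize, Term.realize_le, Term.realize_var, Sum.elim_inl, Sum.elim_inr]
  simp only [cellSentence, Sentence.Realize, Formula.realize_iAlls, Formula.realize_iExs,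
    Formula.realize_relabel]
  have e : ∀ (c : Fin p → M) (b : Fin N → M) (xx : Fin 2 → M),
      (fun a => Sum.elim (Sum.elim ((fun a => Sum.elim (default : Empty → M) c a) ∘ Sum.inr) b) xx a)
        = Sum.elim (Sum.elim c b) xx := by
    intro c b xx
    funext z; rcases z with (z | z) | z <;> rfl
  constructor
  · intro h c
    obtain ⟨b, hb⟩ := h c
    refine ⟨b, fun x x' hxx' => ?_⟩
    have h2 := hb ![x, x']
    rw [e, hbody] at h2
    exact h2 hxx'
  · intro h c
    obtain ⟨b, hb⟩ := h c
    refine ⟨b, fun xx => ?_⟩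
    rw [e, hbody]
    exact hb (xx 0) (xx 1)

end Sentence

/-! ### Step 3: a set constant on cells is a finite union of intervals -/

/-- **A subset of a linear order on which membership only depends on the cell of `N` cut points
is a finite union of points and intervals** (the cells are finite intersections of rays `≤ bᵢ`,
`≥ bᵢ` and their complements). [folklore] -/
theorem isFiniteUnionOfIntervals_of_cells {M : Type*} [LinearOrder M] {N : ℕ} (b : Fin N → M)
    {S : Set M} (h : ∀ x x', SameCell b x x' → (x ∈ S ↔ x' ∈ S)) :
    IsFiniteUnionOfIntervals S := by
  classical
  let pat : M → Fin N → Bool × Bool := fun x i => (decide (x ≤ b i), decide (b i ≤ x))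
  let cellOf : (Fin N → Bool × Bool) → Set M := fun π =>
    ⋂ i ∈ (Finset.univ : Finset (Fin N)),
      ({x | decide (x ≤ b i) = (π i).1} ∩ {x | decide (b i ≤ x) = (π i).2})
  have hcell : ∀ π, IsFiniteUnionOfIntervals (cellOf π) := by
    intro π
    refine IsFiniteUnionOfIntervals.biInter Finset.univ _ fun i _ => ?_
    refine IsFiniteUnionOfIntervals.inter ?_ ?_
    · cases (π i).1
      · have : {x | decide (x ≤ b i) = false} = (Set.Iic (b i))ᶜ := by
          ext x; simp
        rw [this]; exact (isFiniteUnionOfIntervals_Iic _).compl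
      · have : {x | decide (x ≤ b i) = true} = Set.Iic (b i) := by
          ext x; simp
        rw [this]; exact isFiniteUnionOfIntervals_Iic _
    · cases (π i).2
      · have : {x | decide (b i ≤ x) = false} = (Set.Ici (b i))ᶜ := by
          ext x; simp
        rw [this]; exact (isFiniteUnionOfIntervals_Ici _).compl
      · have : {x | decide (b i ≤ x) = true} = Set.Ici (b i) := by
          ext x; simp
        rw [this]; exact isFiniteUnionOfIntervals_Ici _
  have hmem : ∀ x π, x ∈ cellOf π ↔ pat x = π := by
    intro x π
    simp only [cellOf, Set.mem_iInter, Finset.mem_univ, Set.mem_inter_iff, Set.mem_setOf_eq,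
      forall_true_left, funext_iff, Prod.ext_iff, pat]
  let T : Finset (Fin N → Bool × Bool) := Finset.univ.filter fun π => ∃ x ∈ S, pat x = π
  have hS : S = ⋃ π ∈ T, cellOf π := by
    ext x'
    simp only [Set.mem_iUnion, exists_prop, T, Finset.mem_filter, Finset.mem_univ, true_and]
    constructor
    · intro hx'
      exact ⟨pat x', ⟨x', hx', rfl⟩, (hmem x' _).2 rfl⟩
    · rintro ⟨π, ⟨x, hx, rfl⟩, hx'⟩
      have hp : pat x' = pat x := (hmem x' _).1 hx'
      refine (h x x' fun i => ?_).1 hx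
      have h1 := congrFun hp i
      simp only [pat, Prod.mk.injEq, decide_eq_decide] at h1
      exact ⟨h1.1.symm, h1.2.symm⟩
  rw [hS]
  exact IsFiniteUnionOfIntervals.biUnion T cellOf fun π _ => hcell π

/-! ### Assembly over `ℝ`: model completeness ⇒ uniformly many cells -/

section Engine

universe u' v'

variable {L' : FirstOrder.Language.{u', v'}} {p : ℕ}

/-- Unpacking a parametrically `L'`-definable subset of the line: a formula `φ(c̄, x)` with
finitely many parameters `c̄`. [folklore] -/
theorem exists_formula_of_definable₁ {M : Type*} [L'.Structure M] {S : Set M}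
    (hS : (Set.univ : Set M).Definable₁ L' S) :
    ∃ (p : ℕ) (φ : L'.Formula (Fin p ⊕ Fin 1)) (c : Fin p → M),
      ∀ x : M, x ∈ S ↔ φ.Realize (Sum.elim c fun _ => x) := by
  classical
  obtain ⟨A0, -, hA0⟩ := Set.definable_iff_finitely_definable.1 hS
  rw [Set.definable_iff_exists_formula_sum] at hA0
  obtain ⟨φ₀, hφ₀⟩ := hA0
  let e := Fintype.equivFin (↥(↑A0 : Set M))
  refine ⟨Fintype.card (↥(↑A0 : Set M)), φ₀.relabel (Sum.map ⇑e _root_.id),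
    fun i => (e.symm i : M), fun x => ?_⟩
  have hx : x ∈ S ↔ (fun _ : Fin 1 => x) ∈ {v : Fin 1 → M | v 0 ∈ S} := Iff.rfl
  rw [hx, hφ₀]
  simp only [Set.mem_setOf_eq, Formula.realize_relabel, Sum.elim_comp_map, Function.comp_id]
  have ec : ((fun i => (e.symm i : M)) ∘ ⇑e) = fun a : ↥(↑A0 : Set M) => (a : M) := by
    funext a; simp
  rw [ec]


variable [L'.IsOrdered]

/-- **Step 3 packaged: uniformly finitely many cells ⇒ o-minimality.**  An ordered `L'`-structure
in which every formula `φ(c̄, x)` satisfies some cell sentence `cellSentence φ N` is o-minimal.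
[folklore] -/
theorem isOMinimal_of_models_cellSentence {M : Type*} [L'.Structure M] [LinearOrder M]
    [L'.OrderedStructure M] [Nonempty M]
    (h : ∀ (p : ℕ) (φ : L'.Formula (Fin p ⊕ Fin 1)), ∃ N : ℕ, M ⊨ cellSentence φ N) :
    L'.IsOMinimal M := by
  intro S hS
  obtain ⟨p, φ, c, hφ⟩ := exists_formula_of_definable₁ hS
  obtain ⟨N, hN⟩ := h p φ
  obtain ⟨b, hb⟩ := (realize_cellSentence M φ N).1 hN c
  refine isFiniteUnionOfIntervals_of_cells b fun x x' hxx' => ?_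
  rw [hφ x, hφ x']
  exact hb x x' hxx'

variable
  [∀ K : Language.Theory.ModelType.{0, 0, 0} realExpTheory, L'.Structure K]
  [∀ K : Language.Theory.ModelType.{0, 0, 0} realExpTheory, L'.OrderedStructure K]
  {T' : L'.Theory} [∀ K : Language.Theory.ModelType.{0, 0, 0} realExpTheory, (K : Type) ⊨ T']

/-- Appending the line variable: `(c̄, x)` read through `Fin p ⊕ Fin 1 ≃ Fin (p + 1)`. [folklore] -/
theorem snoc_comp_finSumFinEquiv {M : Type*} (c : Fin p → M) (x : M) :
    (Fin.snoc c x : Fin (p + 1) → M) ∘ ⇑finSumFinEquiv = Sum.elim c fun _ : Fin 1 => x := by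
  funext z
  rcases z with i | j
  · simp only [Function.comp_apply, finSumFinEquiv_apply_left, Sum.elim_inl]
    exact Fin.snoc_castSucc (α := fun _ => M) x c i
  · have hj : j = 0 := Subsingleton.elim j 0
    subst hj
    simp only [Function.comp_apply, finSumFinEquiv_apply_right, Sum.elim_inr]
    have : Fin.natAdd p (0 : Fin 1) = Fin.last p := Fin.ext (by simp)
    rw [this]
    exact Fin.snoc_last (α := fun _ => M) x c

/-- Reindexing an exponential term in the unknowns `((c̄, x), -, w̄)` as a term in `(c̄; x, w̄, ·)`
for `exists_noChain_proj_zeroSet_uniform`. [folklore] -/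
theorem exists_reindex_term {m : ℕ}
    (t : Language.orderedExpRing.Term ((Fin (p + 1) ⊕ Fin 0) ⊕ Fin m)) :
    ∃ t₂ : Language.orderedExpRing.Term (Fin p ⊕ Fin (m + 2)), ∀ (c : Fin p → ℝ) (x : ℝ),
      (∃ w : Fin m → ℝ,
          t.realize (Sum.elim (Sum.elim (Fin.snoc c x : Fin (p + 1) → ℝ) Fin.elim0) w) = 0) ↔
        ∃ y : Fin (m + 2) → ℝ, y 0 = x ∧ t₂.realize (Sum.elim c y) = 0 := by
  let ρ : (Fin (p + 1) ⊕ Fin 0) ⊕ Fin m → Fin p ⊕ Fin (m + 2) :=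
    Sum.elim (Sum.elim (fun j => Fin.lastCases (Sum.inr 0) (fun i : Fin p => Sum.inl i) j)
      Fin.elim0) fun k => Sum.inr (Fin.succ (Fin.castSucc k))
  have key : ∀ (c : Fin p → ℝ) (y : Fin (m + 2) → ℝ),
      Sum.elim c y ∘ ρ =
        Sum.elim (Sum.elim (Fin.snoc c (y 0) : Fin (p + 1) → ℝ) Fin.elim0)
          fun k => y (Fin.succ (Fin.castSucc k)) := by
    intro c y
    funext z
    rcases z with (j | k) | k
    · simp only [Function.comp_apply, ρ, Sum.elim_inl]
      refine Fin.lastCases ?_ (fun i => ?_) j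
      · simp
      · simp
    · exact k.elim0
    · rfl
  refine ⟨t.relabel ρ, fun c x => ?_⟩
  constructor
  · rintro ⟨w, hw⟩
    refine ⟨Fin.cons x (Fin.snoc w 0), rfl, ?_⟩
    rw [Term.realize_relabel, key]
    have e : (fun k : Fin m => (Fin.cons x (Fin.snoc w 0 : Fin (m + 1) → ℝ) : Fin (m + 2) → ℝ)
        (Fin.succ (Fin.castSucc k))) = w := by
      funext k
      rw [Fin.cons_succ]
      exact Fin.snoc_castSucc (α := fun _ => ℝ) _ _ k
    rw [Fin.cons_zero, e]
    exact hw
  · rintro ⟨y, rfl, hy⟩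
    refine ⟨fun k => y (Fin.succ (Fin.castSucc k)), ?_⟩
    rw [Term.realize_relabel, key] at hy
    exact hy

/-- **Model completeness + exp-term normal form ⇒ uniformly finitely many cells over `ℝ`.**  If
`T'` is model complete and existential `L'`-formulas reduce to exponential term equations, then
for every `L'`-formula `φ(c̄, x)` there is `N` such that `ℝ` (`realModel`) satisfies the cell
sentence `cellSentence φ N` (steps 1a–1c). [cite: WilkieJAMS1996, Theorem 11.1] -/
theorem realModel_models_cellSentence
    (hnf : ∀ {n : ℕ} {ψ : L'.Formula (Fin n)}, ψ.IsExistential →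
      IsExpTermDefinable (fun (K : Language.Theory.ModelType.{0, 0, 0} realExpTheory)
        (u : Fin n ⊕ Fin 0 → K) => BoundedFormula.Realize ψ (u ∘ Sum.inl) (u ∘ Sum.inr)))
    (hMC : T'.IsModelComplete) (φ : L'.Formula (Fin p ⊕ Fin 1)) :
    ∃ N : ℕ, (realModel : Type) ⊨ cellSentence φ N := by
  -- model completeness: an existential formula equivalent to `φ`
  obtain ⟨ψ, hψ, hiff⟩ := hMC.exists_isExistential_iff (p + 1) (φ.relabel ⇑finSumFinEquiv)
  -- normal form: one exponential term
  obtain ⟨m, t, ht⟩ := hnf hψ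
  obtain ⟨t₂, ht₂⟩ := exists_reindex_term t
  -- Khovanskii: no long chains, uniformly
  obtain ⟨Kc, hKc⟩ := exists_noChain_proj_zeroSet_uniform t₂
  refine ⟨2 * Kc, (realize_cellSentence realModel φ (2 * Kc)).2 fun c => ?_⟩
  -- the section `S_c` (over `ℝ`, the carrier of `realModel`)
  change Fin p → ℝ at c
  set S : Set ℝ := {x : ℝ | Formula.Realize (M := realModel) φ (Sum.elim c fun _ => x)} with hSdef
  have hSx : ∀ x : ℝ, x ∈ S ↔ ∃ y : Fin (m + 2) → ℝ, y 0 = x ∧ t₂.realize (Sum.elim c y) = 0 := by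
    intro x
    refine Iff.trans ?_ (ht₂ c x)
    have h3 := ht realModel (Sum.elim (Fin.snoc c x : Fin (p + 1) → ℝ) Fin.elim0)
    dsimp only at h3
    rw [Sum.elim_comp_inl, Sum.elim_comp_inr] at h3
    refine Iff.trans ?_ h3
    have h1 : Formula.Realize (M := realModel) φ (Sum.elim c fun _ => x) ↔
        Formula.Realize (M := realModel) (φ.relabel ⇑finSumFinEquiv)
          (Fin.snoc c x : Fin (p + 1) → ℝ) := by
      refine Iff.trans ?_ Formula.realize_relabel.symm
      exact iff_of_eq (congrArg (fun v : Fin p ⊕ Fin 1 → ℝ => Formula.Realize (M := realModel) φ v)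
        (snoc_comp_finSumFinEquiv c x).symm)
    have h2 : Formula.Realize (M := realModel) (φ.relabel ⇑finSumFinEquiv)
          (Fin.snoc c x : Fin (p + 1) → ℝ) ↔
        Formula.Realize (M := realModel) ψ (Fin.snoc c x : Fin (p + 1) → ℝ) :=
      hiff.realize_iff
    refine Iff.trans h1 (Iff.trans h2 ?_)
    show BoundedFormula.Realize (M := realModel) ψ (Fin.snoc c x : Fin (p + 1) → ℝ) default ↔ _
    exact iff_of_eq (congrArg (fun xs =>
      BoundedFormula.Realize (M := realModel) ψ (Fin.snoc c x : Fin (p + 1) → ℝ) xs)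
        (Subsingleton.elim _ _))
  have hSeq : S = {x : ℝ | ∃ y : Fin (m + 2) → ℝ, y 0 = x ∧ t₂.realize (Sum.elim c y) = 0} :=
    Set.ext hSx
  have hchain : NoChain Kc S := by rw [hSeq]; exact hKc c
  obtain ⟨hfin, hcard⟩ := finite_frontier_and_ncard_le hchain
  obtain ⟨b, hb⟩ := exists_range_superset_of_ncard_le hfin hcard
  refine ⟨b, fun x x' hxx' => ?_⟩
  exact mem_iff_of_sameCell (S := S) b hb hxx'

/-- **Uniform finiteness in all models of `T_exp`**: granted moreover that `L'`-sentences transfer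
between the models of `T_exp` and `ℝ`, for every `φ(c̄, x)` there is `N` such that in every
`K ⊨ T_exp` every section `{x | φ(c̄, x)}` is a union of cells of some `N` points of `K`.
[cite: WilkieJAMS1996, Theorem 11.1] -/
theorem models_cellSentence
    (hnf : ∀ {n : ℕ} {ψ : L'.Formula (Fin n)}, ψ.IsExistential →
      IsExpTermDefinable (fun (K : Language.Theory.ModelType.{0, 0, 0} realExpTheory)
        (u : Fin n ⊕ Fin 0 → K) => BoundedFormula.Realize ψ (u ∘ Sum.inl) (u ∘ Sum.inr)))
    (htr : ∀ (K : Language.Theory.ModelType.{0, 0, 0} realExpTheory) (σ : L'.Sentence),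
      (K : Type) ⊨ σ ↔ (realModel : Type) ⊨ σ)
    (hMC : T'.IsModelComplete) (φ : L'.Formula (Fin p ⊕ Fin 1)) :
    ∃ N : ℕ, ∀ K : Language.Theory.ModelType.{0, 0, 0} realExpTheory,
      (K : Type) ⊨ cellSentence φ N := by
  obtain ⟨N, hN⟩ := realModel_models_cellSentence hnf hMC φ
  exact ⟨N, fun K => (htr K _).2 hN⟩

/-- **Model completeness + Khovanskii ⇒ o-minimality.**  Let `L'` be an ordered language on the
models of `T_exp` whose existential formulas reduce uniformly to exponential term equations
(`hnf`) and whose sentences transfer between the models of `T_exp` and `ℝ` (`htr`), and let `T'`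
(true in all of them) be model complete.  Then `K | L'` is o-minimal for every model `K` of
`T_exp` (Wilkie 1996, §1: "model completeness … combined with Khovanskii's finiteness theorem
… implies o-minimality"; Theorem 11.1). [cite: WilkieJAMS1996, Theorem 11.1] -/
theorem isOMinimal_of_isModelComplete
    (hnf : ∀ {n : ℕ} {ψ : L'.Formula (Fin n)}, ψ.IsExistential →
      IsExpTermDefinable (fun (K : Language.Theory.ModelType.{0, 0, 0} realExpTheory)
        (u : Fin n ⊕ Fin 0 → K) => BoundedFormula.Realize ψ (u ∘ Sum.inl) (u ∘ Sum.inr)))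
    (htr : ∀ (K : Language.Theory.ModelType.{0, 0, 0} realExpTheory) (σ : L'.Sentence),
      (K : Type) ⊨ σ ↔ (realModel : Type) ⊨ σ)
    (hMC : T'.IsModelComplete) (K : Language.Theory.ModelType.{0, 0, 0} realExpTheory) :
    L'.IsOMinimal K :=
  isOMinimal_of_models_cellSentence fun _ φ =>
    (models_cellSentence hnf htr hMC φ).imp fun _ hN => hN K

/-- **The same for `ℝ` with its own `L'`-structure**, granted that `L'`-sentences transfer between
`ℝ` and its bundled copy `realModel` (for the house expansions both carry literally the same
interpretation, and the transfer is the completeness of `Th(ℝ | L')`). [cite: WilkieJAMS1996, Theorem 11.1] -/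
theorem isOMinimal_real_of_isModelComplete [L'.Structure ℝ] [L'.OrderedStructure ℝ]
    (hnf : ∀ {n : ℕ} {ψ : L'.Formula (Fin n)}, ψ.IsExistential →
      IsExpTermDefinable (fun (K : Language.Theory.ModelType.{0, 0, 0} realExpTheory)
        (u : Fin n ⊕ Fin 0 → K) => BoundedFormula.Realize ψ (u ∘ Sum.inl) (u ∘ Sum.inr)))
    (htrR : ∀ σ : L'.Sentence, (realModel : Type) ⊨ σ → ℝ ⊨ σ)
    (hMC : T'.IsModelComplete) : L'.IsOMinimal ℝ :=
  isOMinimal_of_models_cellSentence fun _ φ =>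
    (realModel_models_cellSentence hnf hMC φ).imp fun _ hN => htrR _ hN

end Engine

end OMinimalOfModelComplete

end Literature.ModelTheory.ExponentialFields
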